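import Summits.QuantumFields.YangMills.Theorems.BalabanUVNodesN08AlphaRegSel

/-!
# Route «BalabanUVNodes», Track-A DAG node N08 = [Balaban1985UV3] — (α) clause, toward (b7) at ALL scales: translation-equivariance and periodicity of
# the `k`-fold average (42)–(43) of [4], and its continuity AT every configuration whose `log`-arguments are in the domain of (21)

Cell `pub-ymgap`, seat `pub-ymgap-dag-n08-d` gen 4, file 8 (director-ym R134 row «CLASS-I in-edge conclusions at the (α) granularity of `RunAlpha`»).
`bears_on: R4∕N08`; filed `--supports stmt-QuantumFields-19903 --as helper`.  Sorry-free, standard axioms.  Kernel facts about the TREE'S OWN objects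
`B7Prop1Explicit.hol ∕ Wcx ∕ Xavg ∕ bavg`, `B7Prop2Explicit.avgIter` ([4] (9), (42), (43)) and the lane's lift `LiftBridge.liftCfg`; used by this seat's
file 9 to ADAPT the selection class so that the in-edge conclusion (b7) of files 3–7 (continuity of the lifted averages on the class) holds BY
CONSTRUCTION at every scale.
* §1 TRANSLATIONS: `hol ∕ Wcx ∕ bavg` commute with lattice translations (`hol_translate`, `Wcx_translate`, `bavg_translate`); the `i`-fold average of a
  configuration translated by `L^i·T` is the `i`-fold average translated by `T` (`avgIter_translate`) — [4] p. 24 «this definition is local … covariant».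
* §2 PERIODICITY: the lift of a torus configuration is `|T_η|`-periodic (`liftCfg_translate_period`), hence its `i`-fold average is periodic with the period
  `sitesPerDir i` of the scale-`i` torus (`avgIter_liftCfg_periodic`, `i ≤ m + K`), and so are its loop variables (`Wcx_avgIter_liftCfg_periodic`).
* §3 CONTINUITY AT A POINT for configuration-valued maps `F : X → (bonds of ℤ^d → 𝔸ˣ)` continuous bondwise at `x₀`: transports (9) (`continuousAt_val_hol`,
  inverses through `Ring.inverse`, `NormedRing.inverse_continuousAt`), loop variables (`continuousAt_val_Wcx`), and — when the `log`-arguments AT `x₀`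
  lie in the unit ball where (21) is analytic (`MatrixLog.analyticAt_mlog`) — the one-step average (42) (`continuousAt_val_bavg`) and the next iterate
  (43) (`continuousAt_val_avgIter_succ`).
HONEST FRAMING: [folklore] bookkeeping over [4]'s definitions; nothing of [B10] ∕ [7] ∕ [4]'s estimates is asserted; count-neutral; NOT a discharge of
N08.  d = 3 lattice gauge theory on finite tori as printed; nothing about d = 4, the continuum, OS axioms, a mass gap or the Clay problem.
-/

noncomputable section

namespace Summit.QuantumFields.YangMills.Theorems.BalabanUVNodesN08AlphaLiftAvgCont

open Set Topology TopologicalSpace NormedSpace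
open scoped Matrix Matrix.Norms.L2Operator BigOperators
open Literature.MathematicalPhysics.QuantumFieldTheory.Balaban1983to89
open Literature.MathematicalPhysics.QuantumFieldTheory.Balaban1985CMP102.Setting
open Summit.QuantumFields.Balaban3D.Proofs.LiftBridge (liftCfg)
open Summit.QuantumFields.Balaban3D.Proofs.TorusLift (projSite)
open B7Prop1Explicit (hol plaqWord e stepHol Letter Wcx Xavg bavg boxVec seg gammaWord expUnit val_expUnit hol_nil hol_cons Wcx_eq_hol_loop)
open B7Prop2Explicit (avgIter avgIter_zero avgIter_succ rescale rescale_apply)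

variable {L : ℕ}

/-! ## §1 Translations -/

section Translate

variable {d : ℕ} {G : Type*} [Group G]

/-- A letter's transport of the translated configuration `x ↦ V(x + T)` is the transport of `V` from the translated base point. [cite: Balaban1985Averaging, (9) p.18] -/
theorem stepHol_translate (V : B7Prop1Explicit.Site d → Fin d → G) (T x : B7Prop1Explicit.Site d) (l : Letter d) :
    stepHol (fun y κ => V (y + T) κ) x l = stepHol V (x + T) l := by
  obtain ⟨μ, b⟩ := l
  cases b <;> simp only [stepHol, add_right_comm, if_true, if_false, Bool.false_eq_true]

/-- **Transports (9) commute with translations**: `(V(· + T))(Γ from x) = V(Γ from x + T)`. [cite: Balaban1985Averaging, (9) p.18] -/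
theorem hol_translate (V : B7Prop1Explicit.Site d → Fin d → G) (T : B7Prop1Explicit.Site d) :
    ∀ (x : B7Prop1Explicit.Site d) (w : List (Letter d)), hol (fun y κ => V (y + T) κ) x w = hol V (x + T) w := by
  intro x w
  induction w generalizing x with
  | nil => simp only [hol_nil]
  | cons l w ih => rw [hol_cons, hol_cons, stepHol_translate, ih, add_right_comm]

variable {𝔸 : Type*} [NormedRing 𝔸] [NormedAlgebra ℂ 𝔸] [CompleteSpace 𝔸]

omit [NormedAlgebra ℂ 𝔸] [CompleteSpace 𝔸] in
/-- The loop variables `V(Γ_{c,x})V(c)⁻¹` of (42) commute with translations. [cite: Balaban1985Averaging, (42) p.23] -/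
theorem Wcx_translate (V : B7Prop1Explicit.Site d → Fin d → 𝔸ˣ) (T q : B7Prop1Explicit.Site d) (κ : Fin d) (r : B7Prop1Explicit.Site d) :
    Wcx L (fun y κ => V (y + T) κ) q κ r = Wcx L V (q + T) κ r := by
  simp only [Wcx_eq_hol_loop, hol_translate]

/-- **The one-step average (42) commutes with translations.** [cite: Balaban1985Averaging, (42) p.23] -/
theorem bavg_translate (V : B7Prop1Explicit.Site d → Fin d → 𝔸ˣ) (T : B7Prop1Explicit.Site d) :
    bavg L (fun y κ => V (y + T) κ) = fun q κ => bavg L V (q + T) κ := by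
  funext q κ
  simp only [bavg, Xavg, Wcx_translate, hol_translate]

/-- **The `i`-fold average (43) of a configuration translated by `L^i·T` is the `i`-fold average translated by `T`** (the rescaling `Lℤ^d ≅ ℤ^d` of each
step divides the translation by `L`). [cite: Balaban1985Averaging, (43) p.24] -/
theorem avgIter_translate (V : B7Prop1Explicit.Site d → Fin d → 𝔸ˣ) :
    ∀ (i : ℕ) (T : B7Prop1Explicit.Site d), avgIter L (fun y κ => V (y + ((L : ℤ) ^ i) • T) κ) i = fun z κ => avgIter L V i (z + T) κ
  | 0, T => by
    funext z κ
    simp only [avgIter_zero, pow_zero, one_smul]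
  | i + 1, T => by
    funext z κ
    have hT : ((L : ℤ) ^ (i + 1)) • T = ((L : ℤ) ^ i) • ((L : ℤ) • T) := by rw [pow_succ, mul_smul]
    rw [avgIter_succ, avgIter_succ, rescale_apply, rescale_apply, hT, avgIter_translate V i ((L : ℤ) • T), bavg_translate, smul_add]

end Translate

/-! ## §2 Periodicity of the lift and of its averages -/

section Periodic

variable {S : Scales L} {G : Type} [GaugeGroup G] [MeasurableSpace G] (𝔊 : GroupModel G)

omit [MeasurableSpace G] in
/-- The projection `ηℤ³ → T_η` is invariant under translation by the period `|T_η|` per direction. [folklore] -/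
theorem projSite_add_period (x v : B7Prop1Explicit.Site S.P.d) :
    projSite (x + (S.P.sitesPerDir 0 : ℤ) • v) = (projSite x : Site S.P 0) := by
  funext κ
  simp [projSite, Pi.add_apply]

/-- **The lift is periodic**: `(lift U)(x + |T_η|·v) = (lift U)(x)`. [cite: Balaban1985UV3, p.256 (torus)] -/
theorem liftCfg_translate_period (U : GaugeField S.P 0 G) (v : B7Prop1Explicit.Site S.P.d) :
    (fun y κ => liftCfg 𝔊 U (y + (S.P.sitesPerDir 0 : ℤ) • v) κ) = liftCfg 𝔊 U := by
  funext y κ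
  simp only [liftCfg, projSite_add_period]

omit [MeasurableSpace G] in
/-- `|T_η| = L^i · |T^{(i)}|` per direction for `i ≤ m + K`. [folklore] -/
theorem sitesPerDir_zero_eq {i : ℕ} (hi : i ≤ S.P.m + S.P.K) : S.P.sitesPerDir 0 = S.P.L ^ i * S.P.sitesPerDir i := by
  unfold Params.sitesPerDir
  rw [Nat.sub_zero, mul_left_comm, ← pow_add, Nat.add_sub_cancel' hi]

/-- **The `i`-fold average of the lift is periodic with the period of the scale-`i` torus** (`i ≤ m + K`, block size `S.P.L = L`).
[cite: Balaban1985Averaging, (43) p.24; Balaban1985UV3, p.256] -/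
theorem avgIter_liftCfg_periodic (hL : S.P.L = L) {i : ℕ} (hi : i ≤ S.P.m + S.P.K) (U : GaugeField S.P 0 G) (z v : B7Prop1Explicit.Site S.P.d)
    (κ : Fin S.P.d) :
    avgIter L (liftCfg 𝔊 U) i (z + (S.P.sitesPerDir i : ℤ) • v) κ = avgIter L (liftCfg 𝔊 U) i z κ := by
  have h := congrFun (congrFun (avgIter_translate (L := L) (liftCfg 𝔊 U) i ((S.P.sitesPerDir i : ℤ) • v)) z) κ
  rw [← h]
  have hper : ((L : ℤ) ^ i) • ((S.P.sitesPerDir i : ℤ) • v) = (S.P.sitesPerDir 0 : ℤ) • v := by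
    rw [smul_smul, sitesPerDir_zero_eq hi, hL]
    push_cast
    ring_nf
  rw [hper, liftCfg_translate_period]

/-- Hence the loop variables of the averaged lift are periodic too. [cite: Balaban1985Averaging, (42)–(43) pp.23–24] -/
theorem Wcx_avgIter_liftCfg_periodic (hL : S.P.L = L) {i : ℕ} (hi : i ≤ S.P.m + S.P.K) (U : GaugeField S.P 0 G)
    (q v : B7Prop1Explicit.Site S.P.d) (κ : Fin S.P.d) (r : B7Prop1Explicit.Site S.P.d) :
    Wcx L (avgIter L (liftCfg 𝔊 U) i) (q + (S.P.sitesPerDir i : ℤ) • v) κ r = Wcx L (avgIter L (liftCfg 𝔊 U) i) q κ r := by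
  have hfun : (fun y κ' => avgIter L (liftCfg 𝔊 U) i (y + (S.P.sitesPerDir i : ℤ) • v) κ') = avgIter L (liftCfg 𝔊 U) i := by
    funext y κ'
    exact avgIter_liftCfg_periodic 𝔊 hL hi U y v κ'
  rw [← Wcx_translate, hfun]

end Periodic

/-! ## §3 Continuity at a point of transports, loop variables, the one-step average and the next iterate -/

section ContinuousAt

variable {d : ℕ} {X : Type*} [TopologicalSpace X] {𝔸 : Type*} [NormedRing 𝔸] [NormedAlgebra ℂ 𝔸] [CompleteSpace 𝔸]
  {F : X → B7Prop1Explicit.Site d → Fin d → 𝔸ˣ} {x₀ : X}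

omit [NormedAlgebra ℂ 𝔸] in
/-- A letter's transport is continuous at `x₀` once the bond variables are (inverses through `Ring.inverse`, continuous at units of a complete normed
ring). [folklore] -/
theorem continuousAt_val_stepHol (hF : ∀ (y : B7Prop1Explicit.Site d) (μ : Fin d), ContinuousAt (fun x => (F x y μ : 𝔸)) x₀)
    (y : B7Prop1Explicit.Site d) (l : Letter d) : ContinuousAt (fun x => ((stepHol (F x) y l : 𝔸ˣ) : 𝔸)) x₀ := by
  obtain ⟨μ, b⟩ := l
  cases b with
  | true =>
    simp only [stepHol, if_true]
    exact hF y μ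
  | false =>
    simp only [stepHol, Bool.false_eq_true, if_false, ← Ring.inverse_unit]
    exact ContinuousAt.comp (f := fun x => ((F x (y + Letter.vec (μ, false)) μ : 𝔸ˣ) : 𝔸)) (g := Ring.inverse)
      (NormedRing.inverse_continuousAt (F x₀ (y + Letter.vec (μ, false)) μ)) (hF _ μ)

omit [NormedAlgebra ℂ 𝔸] in
/-- **Transports (9) are continuous at `x₀`** once the bond variables are. [cite: Balaban1985Averaging, (9) p.18] -/
theorem continuousAt_val_hol (hF : ∀ (y : B7Prop1Explicit.Site d) (μ : Fin d), ContinuousAt (fun x => (F x y μ : 𝔸)) x₀) :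
    ∀ (y : B7Prop1Explicit.Site d) (w : List (Letter d)), ContinuousAt (fun x => ((hol (F x) y w : 𝔸ˣ) : 𝔸)) x₀ := by
  intro y w
  induction w generalizing y with
  | nil =>
    simp only [hol_nil, Units.val_one]
    exact continuousAt_const
  | cons l w ih =>
    simp only [hol_cons, Units.val_mul]
    exact (continuousAt_val_stepHol hF y l).mul (ih (y + l.vec))

omit [NormedAlgebra ℂ 𝔸] in
/-- The loop variables `F(x)(Γ_{c,x'})F(x)(c)⁻¹` of (42) are continuous at `x₀`. [cite: Balaban1985Averaging, (42) p.23] -/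
theorem continuousAt_val_Wcx (hF : ∀ (y : B7Prop1Explicit.Site d) (μ : Fin d), ContinuousAt (fun x => (F x y μ : 𝔸)) x₀)
    (q : B7Prop1Explicit.Site d) (κ : Fin d) (r : B7Prop1Explicit.Site d) :
    ContinuousAt (fun x => ((Wcx L (F x) q κ r : 𝔸ˣ) : 𝔸)) x₀ := by
  simp only [Wcx_eq_hol_loop]
  exact continuousAt_val_hol hF _ _

/-- **THE ONE-STEP AVERAGE (42) IS CONTINUOUS AT `x₀`** once the bond variables are and every `log`-argument AT `x₀` lies in the unit ball, where the
series (21) is analytic (`MatrixLog.analyticAt_mlog`). [cite: Balaban1985Averaging, (42) p.23 + (21) p.21] -/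
theorem continuousAt_val_bavg (hF : ∀ (y : B7Prop1Explicit.Site d) (μ : Fin d), ContinuousAt (fun x => (F x y μ : 𝔸)) x₀)
    (q : B7Prop1Explicit.Site d) (κ : Fin d) (hsmall : ∀ r : Fin d → Fin L, ‖((Wcx L (F x₀) q κ (boxVec L r) : 𝔸ˣ) : 𝔸) - 1‖ < 1) :
    ContinuousAt (fun x => ((bavg L (F x) q κ : 𝔸ˣ) : 𝔸)) x₀ := by
  letI : NormedAlgebra ℚ 𝔸 := NormedAlgebra.restrictScalars ℚ ℂ 𝔸
  have hterm : ∀ r : Fin d → Fin L, ContinuousAt (fun x => MatrixLog.mlog ((Wcx L (F x) q κ (boxVec L r) : 𝔸ˣ) : 𝔸)) x₀ := fun r =>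
    ContinuousAt.comp (f := fun x => ((Wcx L (F x) q κ (boxVec L r) : 𝔸ˣ) : 𝔸)) (MatrixLog.analyticAt_mlog (hsmall r)).continuousAt
      (continuousAt_val_Wcx hF q κ _)
  have hX : ContinuousAt (fun x => Xavg L (F x) q κ) x₀ := by
    simp only [Xavg]
    exact tendsto_finsetSum _ fun r _ => (hterm r).const_smul _
  simp only [bavg, Units.val_mul, val_expUnit]
  exact (exp_continuous.continuousAt.comp hX).mul (continuousAt_val_hol hF _ _)

/-- **THE NEXT ITERATE (43) IS CONTINUOUS AT `x₀`**: if every bond variable of the `i`-fold average is continuous at `x₀` and the `log`-arguments of the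
`i`-fold average AT `x₀` around the coarse bond `(Lz, κ)` lie in the unit ball, `x ↦ Ū^{i+1}(F x)(z, κ)` is continuous at `x₀`.
[cite: Balaban1985Averaging, (43) p.24] -/
theorem continuousAt_val_avgIter_succ (i : ℕ)
    (hF : ∀ (y : B7Prop1Explicit.Site d) (μ : Fin d), ContinuousAt (fun x => ((avgIter L (F x) i y μ : 𝔸ˣ) : 𝔸)) x₀)
    (z : B7Prop1Explicit.Site d) (κ : Fin d)
    (hsmall : ∀ r : Fin d → Fin L, ‖((Wcx L (avgIter L (F x₀) i) ((L : ℤ) • z) κ (boxVec L r) : 𝔸ˣ) : 𝔸) - 1‖ < 1) :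
    ContinuousAt (fun x => ((avgIter L (F x) (i + 1) z κ : 𝔸ˣ) : 𝔸)) x₀ := by
  simp only [avgIter_succ, rescale_apply]
  exact continuousAt_val_bavg (F := fun x => avgIter L (F x) i) hF _ κ hsmall

end ContinuousAt

end Summit.QuantumFields.YangMills.Theorems.BalabanUVNodesN08AlphaLiftAvgCont

end
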